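import Summits.CriticalPhenomena.PercolationContinuityZ3.Theorems.Transplant.Slab111HubT03P1
import Summits.CriticalPhenomena.PercolationContinuityZ3.Theorems.Transplant.Slab111HubT03P2
import Summits.CriticalPhenomena.PercolationContinuityZ3.Theorems.Transplant.Slab111HubT03P3
import Summits.CriticalPhenomena.PercolationContinuityZ3.Theorems.Transplant.Slab111HubT03P4
import Summits.CriticalPhenomena.PercolationContinuityZ3.Theorems.Transplant.Slab111HubT03P5
import Summits.CriticalPhenomena.PercolationContinuityZ3.Theorems.Transplant.Slab111HubT03P6
import Summits.CriticalPhenomena.PercolationContinuityZ3.Theorems.Transplant.Slab111HubT03P7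
import Summits.CriticalPhenomena.PercolationContinuityZ3.Theorems.Transplant.Slab111HubT03P8
import Summits.CriticalPhenomena.PercolationContinuityZ3.Theorems.Transplant.Slab111HubT03P9
import Summits.CriticalPhenomena.PercolationContinuityZ3.Theorems.Transplant.Slab111HubT03P10
import Summits.CriticalPhenomena.PercolationContinuityZ3.Theorems.Transplant.Slab111HubT03P11
import Summits.CriticalPhenomena.PercolationContinuityZ3.Theorems.Transplant.Slab111HubT03P12
import Summits.CriticalPhenomena.PercolationContinuityZ3.Theorems.Transplant.Slab111HubT03P13
import Summits.CriticalPhenomena.PercolationContinuityZ3.Theorems.Transplant.Slab111HubT03P14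
import Summits.CriticalPhenomena.PercolationContinuityZ3.Theorems.Transplant.Slab111HubT03P15
import Summits.CriticalPhenomena.PercolationContinuityZ3.Theorems.Transplant.Slab111HubT03P16
import Summits.CriticalPhenomena.PercolationContinuityZ3.Theorems.Transplant.Slab111HubT03P17
import Summits.CriticalPhenomena.PercolationContinuityZ3.Theorems.Transplant.Slab111HubT03P18
import Summits.CriticalPhenomena.PercolationContinuityZ3.Theorems.Transplant.Slab111HubT03P19
import Summits.CriticalPhenomena.PercolationContinuityZ3.Theorems.Transplant.Slab111HubT03P20
import Summits.CriticalPhenomena.PercolationContinuityZ3.Theorems.Transplant.Slab111HubT03P21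
import Summits.CriticalPhenomena.PercolationContinuityZ3.Theorems.Transplant.Slab111HubT03P22
import Summits.CriticalPhenomena.PercolationContinuityZ3.Theorems.Transplant.Slab111HubT03P23
import Summits.CriticalPhenomena.PercolationContinuityZ3.Theorems.Transplant.Slab111HubT03P24
import Summits.CriticalPhenomena.PercolationContinuityZ3.Theorems.Transplant.Slab111HubT03P25
import Summits.CriticalPhenomena.PercolationContinuityZ3.Theorems.Transplant.Slab111HubT03P26
import Summits.CriticalPhenomena.PercolationContinuityZ3.Theorems.Transplant.Slab111HubT03P27
import Summits.CriticalPhenomena.PercolationContinuityZ3.Theorems.Transplant.Slab111HubT03P28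
import Summits.CriticalPhenomena.PercolationContinuityZ3.Theorems.Transplant.Slab111HubT03P29
import Summits.CriticalPhenomena.PercolationContinuityZ3.Theorems.Transplant.Slab111HubT03P30
import Summits.CriticalPhenomena.PercolationContinuityZ3.Theorems.Transplant.Slab111HubT03R1
import Summits.CriticalPhenomena.PercolationContinuityZ3.Theorems.Transplant.Slab111HubT03R2
import Summits.CriticalPhenomena.PercolationContinuityZ3.Theorems.Transplant.Slab111HubT03R3
import HarnessLib

/-!
# The HUB ROUTING of the `(111)`-films — all tables of the shape `T03` and the node `linkage_T03` at its block types

builds on p205010 (kernel theorem, internal audit signed; external expert review pending) — NOT used in this file.  Lane `prim-bschramm`, seat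
`prim-bschramm-p2` (gen 36; class C1b; memo `HOME/bschramm/P2-LATTICES.md` §131–132); helper file (`--supports stmt-CriticalPhenomena-4575 --as helper`).
**`tabs_T03`** collects the kernel-checked tables of the shape (files `Slab111HubT03P*`); **`linkage_T03`** =
«Slab111HubShapeLink4».`linkage_of_shape4` for «Slab111HubShapeT03» at every block type of its family (`k ≥ 51`).
[cite: DuminilCopinSidoraviciusTassion2016, §2.3 (proof of Fact 2: the three disjoint paths γ_u, γ_v, γ_w in B_R(z))]
-/

noncomputable section

namespace Summit.CriticalPhenomena.PercolationContinuityZ3.Theorems.Transplant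

open Literature.Probability.Percolation Literature.Probability.LatticeModels SimpleGraph

namespace Slab111

/-- **ALL TABLES OF THE SHAPE `T03`** (nonzero region columns). [folklore] -/
theorem tabs_T03 : ∀ q₁ ∈ shapeT03.cols, q₁ ≠ (0, 0) → shapeT03.pcB q₁ = true → ∀ q₂ ∈ shapeT03.cols, q₂ ≠ (0, 0) → shapeT03.pcB q₂ = true →
    ∃ A C : ℕ, tab4OK shapeT03.pcB shapeT03.colsB shapeT03.badG shapeT03.filtG shapeT03.cols q₁ q₂ A C = true := by
  intro q₁ h₁ h01 hp1
  have h₁' : q₁ ∈ ([(0, 0), (1, 0), (0, -1), (-1, 1), (-1, 0), (0, 1), (1, -1), (2, 0), (0, -2), (-2, 2), (-2, 0), (0, 2), (2, -2), (1, 1), (2, -1), (1, -2), (-1, -1), (-2, 1), (-1, 2), (-3, 1), (-3, 2), (-2, -1), (-2, 3), (-1, -2), (-1, 3), (1, -3), (1, 2), (2, -3), (2, 1), (3, -3), (3, -2), (3, -1), (3, 0)] : List (ℤ × ℤ)) := h₁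
  simp only [List.mem_cons, List.not_mem_nil, or_false] at h₁'
  rcases h₁' with rfl | rfl | rfl | rfl | rfl | rfl | rfl | rfl | rfl | rfl | rfl | rfl | rfl | rfl | rfl | rfl | rfl | rfl | rfl | rfl | rfl | rfl | rfl | rfl | rfl | rfl | rfl | rfl | rfl | rfl | rfl | rfl | rfl
  · exact absurd rfl h01
  · exact absurd hp1 (by decide)
  · exact rowT03_1
  · exact rowT03_2
  · exact rowT03_3
  · exact rowT03_4
  · exact absurd hp1 (by decide)
  · exact absurd hp1 (by decide)
  · exact rowT03_5
  · exact rowT03_6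
  · exact rowT03_7
  · exact rowT03_8
  · exact absurd hp1 (by decide)
  · exact absurd hp1 (by decide)
  · exact absurd hp1 (by decide)
  · exact absurd hp1 (by decide)
  · exact rowT03_9
  · exact rowT03_10
  · exact rowT03_11
  · exact rowT03_12
  · exact rowT03_13
  · exact rowT03_14
  · exact rowT03_15
  · exact rowT03_16
  · exact rowT03_17
  · exact absurd hp1 (by decide)
  · exact absurd hp1 (by decide)
  · exact absurd hp1 (by decide)
  · exact absurd hp1 (by decide)
  · exact absurd hp1 (by decide)
  · exact absurd hp1 (by decide)
  · exact absurd hp1 (by decide)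
  · exact absurd hp1 (by decide)

/-- **THE NODE OF `ShapedLinkage 3` AT EVERY BLOCK OF THE SHAPE `T03`** (`k ≥ 51`). [folklore] -/
theorem linkage_T03 {k : ℕ} (hk : 51 ≤ k) (z : Site 2) {tD sR sD : ℕ} (htD : 3 ≤ tD) (hsR : 3 ≤ sR) (hsD : sR ≤ sD) :
    ∃ W : Set (slab111 k), (∀ x ∈ W, (hexShadow k).sh x ∈ blkR 3 z tD sD) ∧
      (∀ x, (hexShadow k).sh x ∈ hexBall z 1 → (hexShadow k).sh x ∈ blkR 3 z tD sD → x ∈ W) ∧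
      ∀ (E₁ E₂ w' : slab111 k), (hexShadow k).Terminals 3 z 0 tD sR W E₁ E₂ w' →
        ∃ r₁ r₂ : VRouteData (film k) (W ∩ (hexShadow k).lift (blkR 3 z 0 sR)) W E₁ E₂ w', r₁.y = r₂.b ∧ r₁.b = r₂.y :=
  linkage_of_shape4 hk (shapeT03_valid htD hsR hsD) tabs_T03 z

end Slab111

end Summit.CriticalPhenomena.PercolationContinuityZ3.Theorems.Transplant

end
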